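import Summits.NavierStokesRegularity.NavierStokesRegularity.Theorems.QuarterLogPincerTypeIQuantSubcubicExpLiouvilleTransfer
import Summits.NavierStokesRegularity.NavierStokesRegularity.Theses.SymmetryModuliCount
import Literature.Analysis.FluidPDE.SelfSimilar
import HarnessLib

/-!
# Calibration of the non-enveloped residue of S3 — refuter side, negative lane

Crux `stmt-NavierStokesRegularity-24077` (`QuarterLogPincer.TypeIQuantSubcubicExp`), line
`thin_cascade`, stub S3 `stub_thinCascadeLiouville : ∀ M q v g, ¬ ThinObject M q v g`; companion of
`Negative/ThinCascadeEnvelopeSplit.lean` (S3 ⟺ `FiniteDissipationLiouville` ∧ R, with the residue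
`R := ∀ M q v g, ThinObject M q v g → (∀ A, ¬ HasTypeIDecay A v) → False`, "no NON-enveloped thin
object"). Nothing here asserts S3, R, 24077, 4050 or any crux: implications between OPEN
statements and one elementary bound. No summit statement is proved by this file. (Imports are
route-independent apart from the route file `Theses.SymmetryModuliCount` itself, needed to NAME
item 4050.)

## Findings (kernel-checked below)

1. FLOOR OF THE RESIDUE AS A CLASS OF OBJECTS. `not_singularAt_of_hasTypeIDecay`: a field with a
   space–time Type-I envelope `‖v(t,x)‖ ≤ A/(‖x‖+√(−t))` is bounded by `2A/‖a‖` on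
   `(−∞, 0) × B(a, ‖a‖/2)` at every `a ≠ 0`, hence NOT `SingularAt v a`; so
   (`not_hasTypeIDecay_of_singularAt`) a thin object with a SECOND time-`0` singular point `a ≠ 0`
   carries no envelope and lies in `R`. The log-thin budget of `ThinObject` constrains the trace only
   on `1 < ‖x‖`, so extra singular points in the closed unit ball are excluded by no clause, while the
   critical elements behind 22144 / 24453 / 24374 are enveloped, i.e. apex-only singular at time `0`.
2. CEILING. `thinCascadeLiouville_of_typeIAncientLiouville`: item stmt-4050
   (`SymmetryModuliCount.TypeIAncientLiouville`, (L′) in the KNSS gauge) ⇒ S3, using only the gauge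
   and singular clauses (`ThinCascade.not_thinObject_of_rateLiouville`); hence
   `residue_of_typeIAncientLiouville` (4050 ⇒ R). Item 0057 (`LiouvilleConjectureNS`, KNSS (L))
   implies 4050 by the landed `FrequencyRigidity.TwoEndedPinning.typeIAncientLiouville_of_liouvilleConjectureNS`
   (not imported here, to keep this file out of that route's cone). With
   `Negative/ThinCascadeLiouvilleHardness.lean` this brackets the stub:
   `TypeIDSSLiouvilleConjecture ⟸ S3 ⟸ TypeIAncientLiouville (4050) ⟸ LiouvilleConjectureNS (0057)`,
   and the residue `R` alone already follows from 4050.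
-/

-- the summit and its single sub-problem share the name (CONVENTIONS §1), as in every Theorems file
set_option linter.dupNamespace false

namespace Summit.NavierStokesRegularity.NavierStokesRegularity.Theorems.TypeIQuantSubcubicExp.Negative

open Set Metric
open Literature.Analysis Literature.Analysis.FluidPDE
open Summit.NavierStokesRegularity.NavierStokesRegularity.Theorems
open Summit.NavierStokesRegularity.NavierStokesRegularity.Cruxes.TypeIQuantSubcubicExp.ThinCascade
  (ThinObject SingularAt)

/-! ### 1. An enveloped field is singular at time `0` only at the apex -/

/-- **Off-apex bound from the envelope**: `‖v(t,y)‖ ≤ 2A/‖a‖` for `t < 0` and `y ∈ B(a, ‖a‖/2)`,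
`a ≠ 0`. [folklore] -/
theorem norm_le_of_hasTypeIDecay_of_mem_ball {A : ℝ}
    {v : ℝ → EuclideanSpace ℝ (Fin 3) → EuclideanSpace ℝ (Fin 3)} (hdec : HasTypeIDecay A v)
    {a y : EuclideanSpace ℝ (Fin 3)} (ha : a ≠ 0) (hy : y ∈ ball a (‖a‖ / 2)) {t : ℝ}
    (ht : t < 0) : ‖v t y‖ ≤ 2 * A / ‖a‖ := by
  have hapos : 0 < ‖a‖ := norm_pos_iff.2 ha
  have hya : ‖a‖ / 2 ≤ ‖y‖ := by
    have h1 : dist y a < ‖a‖ / 2 := mem_ball.1 hy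
    rw [dist_eq_norm] at h1
    have h2 : ‖a‖ - ‖y‖ ≤ ‖a - y‖ := norm_sub_norm_le a y
    rw [← norm_neg (a - y), neg_sub] at h2
    linarith
  have hden : 0 < ‖y‖ + Real.sqrt (-t) := by
    have := Real.sqrt_nonneg (-t); linarith
  have hvt := hdec t ht y
  by_cases hA : 0 ≤ A
  · calc ‖v t y‖ ≤ A / (‖y‖ + Real.sqrt (-t)) := hvt
      _ ≤ A / (‖a‖ / 2) := by
        apply div_le_div_of_nonneg_left hA (by positivity)
        have := Real.sqrt_nonneg (-t); linarith
      _ = 2 * A / ‖a‖ := by field_simp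
  · push Not at hA
    have h1 : A / (‖y‖ + Real.sqrt (-t)) < 0 := div_neg_of_neg_of_pos hA hden
    have h2 : (0 : ℝ) ≤ ‖v t y‖ := norm_nonneg _
    linarith

/-- **An enveloped field is not singular at any `a ≠ 0` at time `0`.** [folklore] -/
theorem not_singularAt_of_hasTypeIDecay {A : ℝ}
    {v : ℝ → EuclideanSpace ℝ (Fin 3) → EuclideanSpace ℝ (Fin 3)} (hdec : HasTypeIDecay A v)
    {a : EuclideanSpace ℝ (Fin 3)} (ha : a ≠ 0) : ¬ SingularAt v a := by
  intro hsing
  have hapos : 0 < ‖a‖ := norm_pos_iff.2 ha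
  obtain ⟨t, ht, y, hy, hlt⟩ := hsing (‖a‖ / 2) (by positivity) (2 * A / ‖a‖)
  exact absurd (norm_le_of_hasTypeIDecay_of_mem_ball hdec ha hy ht.2) (not_le.2 hlt)

/-- **A second time-`0` singular point rules out every envelope**: such a field lies in the
non-enveloped residue `R` of the split of S3. [folklore] -/
theorem not_hasTypeIDecay_of_singularAt
    {v : ℝ → EuclideanSpace ℝ (Fin 3) → EuclideanSpace ℝ (Fin 3)} {a : EuclideanSpace ℝ (Fin 3)}
    (ha : a ≠ 0) (hsing : SingularAt v a) (A : ℝ) : ¬ HasTypeIDecay A v :=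
  fun hdec => not_singularAt_of_hasTypeIDecay hdec ha hsing

/-! ### 2. Ceiling: (L′) (item 4050) implies S3 and its residue -/

/-- **Item stmt-4050 (`TypeIAncientLiouville`, (L′) in the KNSS gauge) ⇒ S3** (the registered
signature of `stub_thinCascadeLiouville` as conclusion; CONDITIONAL, 4050 is open): only the gauge
clause and the singular clause of `ThinObject` are used. [folklore] -/
theorem thinCascadeLiouville_of_typeIAncientLiouville
    (h : Summit.NavierStokesRegularity.NavierStokesRegularity.Theses.SymmetryModuliCount.TypeIAncientLiouville) :
    ∀ (M q : ℝ) (v : ℝ → EuclideanSpace ℝ (Fin 3) → EuclideanSpace ℝ (Fin 3))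
      (g : EuclideanSpace ℝ (Fin 3) → EuclideanSpace ℝ (Fin 3)), ¬ ThinObject M q v g :=
  fun M q v g => ThinCascade.not_thinObject_of_rateLiouville
    (fun w hw => h M w (isTypeIAncientMild_iff.1 hw)) q v g

/-- **Item stmt-4050 ⇒ the non-enveloped residue `R`** of the split of S3. [folklore] -/
theorem residue_of_typeIAncientLiouville
    (h : Summit.NavierStokesRegularity.NavierStokesRegularity.Theses.SymmetryModuliCount.TypeIAncientLiouville) :
    ∀ (M q : ℝ) (v : ℝ → EuclideanSpace ℝ (Fin 3) → EuclideanSpace ℝ (Fin 3))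
      (g : EuclideanSpace ℝ (Fin 3) → EuclideanSpace ℝ (Fin 3)),
      ThinObject M q v g → (∀ A : ℝ, ¬ HasTypeIDecay A v) → False :=
  fun M q v g hthin _ => thinCascadeLiouville_of_typeIAncientLiouville h M q v g hthin

end Summit.NavierStokesRegularity.NavierStokesRegularity.Theorems.TypeIQuantSubcubicExp.Negative
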